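import Summits.QuantumFields.YangMills.Theorems.BalabanUVNodesN06SectDUnitsAtPinsPhysQ
import Literature.MathematicalPhysics.QuantumFieldTheory.Balaban1983to89.B9Thm311KnitRow17ThresholdsY
import Literature.MathematicalPhysics.QuantumFieldTheory.Balaban1983to89.Node00.OpsYRecordV11
import Literature.MathematicalPhysics.QuantumFieldTheory.Balaban1983to89.Node00.OpsYSectDCoordsQ
import Literature.MathematicalPhysics.QuantumFieldTheory.Balaban1983to89.B9BackgroundsKLevelV1R
import Literature.MathematicalPhysics.QuantumFieldTheory.Balaban1983to89.Node00.OpsYDelta2FormQ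

/-!
# BalabanUVNodes ∕ N06 ([B9], `Dag.B9_main`) — THE rows-19 INVERSE LAWS `G·Δ_a = Δ_a·G = 1` OF THE BOND-SECTOR WALK RECORD AT THE PINNED `Δ_a`-LETTER
# `ΔaA x := S0coKq … (qKnitOfRecord …) (qsKnitOfRecord …) (parKnitY …) (GpPhysY …)`, AT SECTION-CARRYING MEMBERS, FROM THEOREM 3.11 (door (b2) of HOME `W-b-3105-MEMO.md`)
Track A of `YM-PLAN.md` (cell `pub-ymgap`, HUMAN RULING D-0062), node **N06**.  Seat `pub-ymgap-dag-n06-d` g32.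

T. Bałaban, *Propagators for lattice gauge theories in a background field*, Commun. Math. Phys. **99** (1985) 389–434 [Balaban1985BackgroundPropagators] = [B9]: (3.26)–(3.27) p. 395
(`Δ_a = Δ + DRD* + Q*aQ`, `G(U) = (Δ_a)⁻¹`), Thm 3.11 p. 416 («Δ_a(U) is a symmetric, positive definite … operator»), (3.19) p. 393 (the knit pair), (3.35) p. 396.

WHAT.  The heads «KESC-A…»∕«KE₉X-A…» display `hlawsA`.1∕.2 = `GcoK … (𝔏 x).GA U * ΔaA x U = 1 ∧ ΔaA x U * GcoK … (𝔏 x).GA U = 1` for a FREE `Δ_a`-letter `ΔaA`.  At the pin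
`ΔaA x := S0coKq x.toKIdx (trBasis N) (bg9YR …) id (qKnitOfRecord …) (qsKnitOfRecord …) (parKnitY …) (GpPhysY … (parKnitY …))` (def-Y's coordinate model of print's `Δ_a` at the knit pair
— dag-n06-j ∕ node00-def-Y words, bus 2026-08-31) both laws are THEOREMS at every SECTION-CARRYING member on (3.35), from Thm 3.11's positivity of `Δ_a` at the knit pair
(✓`B9Thm311KnitRow17ThresholdsY.symm_posDefTr_deltaAQY_knitRecord_at_scMember_at`, thresholds `knitRow17M₁ ∕ knitRow17a₁`) through def-Y's ✓`OpsYSectDCoordsQ.GcoK_GAQY_mul_S0coKq`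
and the record identity ✓`OpsYRecordV11.lettersYOfRecordV11K_GA_phys`; the reverse order by `mul_eq_one_comm` (finite dimension).  ★ `invLaws_GcoK_GA_S0coKq_at_scMember`.
HONEST FRAMING.  Helper (kernel bookkeeping over landed theorems; 0 `def`, 0 `sorry`), COUNT-NEUTRAL (`--supports stmt-QuantumFields-27239 --as helper`); the member must CARRY
SECTIONS (`β` onto) — at inner-corner members Thm 3.11's positivity at the knit pair is OPEN in the tree (№524 label), so a member-wide consumer keeps a displayed row there; nothing
of [B9] asserted; N06 NOT discharged; K1 NOT closed; nothing continuum ∕ OS ∕ mass gap ∕ Clay.  NEW file.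
-/
noncomputable section

namespace Summit.QuantumFields.YangMills.BalabanUVNodes.N06DeltaAInverseAtRecord
open Literature.MathematicalPhysics.QuantumFieldTheory.Balaban1983to89
open Literature.MathematicalPhysics.QuantumFieldTheory.Balaban1983to89.Node00
open Literature.MathematicalPhysics.QuantumFieldTheory.Balaban1983to89.B6Ineq2142KLevelV1 (β)
open Literature.MathematicalPhysics.QuantumFieldTheory.Balaban1983to89.B9PinMembersKLevelV1 (MemberY geo9Y)
open Literature.MathematicalPhysics.QuantumFieldTheory.Balaban1983to89.B9PinGeometryKLevelV1 (c35Y)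
open Literature.MathematicalPhysics.QuantumFieldTheory.Balaban1983to89.B9BackgroundsKLevelV1P (bg9YP)
open Literature.MathematicalPhysics.QuantumFieldTheory.Balaban1983to89.B9BackgroundsKLevelV1R (RegFamY bg9YR)
open Literature.MathematicalPhysics.QuantumFieldTheory.Balaban1983to89.B7Prop2SpecialUnitary (specialUnitaryUnits)
open Literature.MathematicalPhysics.QuantumFieldTheory.Balaban1983to89.B9CoReadingCoords (GcoK)
open Literature.MathematicalPhysics.QuantumFieldTheory.Balaban1983to89.B9CoReadingCoordsTranspose (trBasis)
open Literature.MathematicalPhysics.QuantumFieldTheory.Balaban1983to89.Node00.OpsYSectDCoords (cR39_trBasis_pos)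
open Literature.MathematicalPhysics.QuantumFieldTheory.Balaban1983to89.Node00.OpsYOps312OfRecordPar (S0coKq)
open Literature.MathematicalPhysics.QuantumFieldTheory.Balaban1983to89.Node00.OpsYSectDCoordsQ (GcoK_GAQY_mul_S0coKq)
open Literature.MathematicalPhysics.QuantumFieldTheory.Balaban1983to89.B9Thm39ReadingCoords (cR39)
open Literature.MathematicalPhysics.QuantumFieldTheory.Balaban1983to89.Node00.OpsYQLetter (qKnitOfRecord qsKnitOfRecord)
open Literature.MathematicalPhysics.QuantumFieldTheory.Balaban1983to89.B9B8AveragingJunction (parKnitY)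
open Literature.MathematicalPhysics.QuantumFieldTheory.Balaban1983to89.B9Thm311KnitRow17ThresholdsY (knitRow17M₁ knitRow17a₁ symm_posDefTr_deltaAQY_knitRecord_at_scMember_at)
open Summit.QuantumFields.YangMills.BalabanUVNodes.N06SectDUnitsAtPinsPhysQ (isUnit_deltaAQY_phys_of_posDefTr)
open scoped Matrix.Norms.L2Operator

variable {N : ℕ} [NeZero N] [Nonempty (Fin N)] (θ : Stage3Params) (Mstar : ℕ)

set_option maxHeartbeats 1600000 in
/-- ★ **BOTH rows-19 INVERSE LAWS AT THE PINNED `Δ_a`-LETTER, AT A SECTION-CARRYING MEMBER ON (3.35)**: with `𝔏 := lettersYOfRecordV11K … x` (so `𝔏.GA = G(U)` at the knit pair fed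
`G′_phys`) and `ΔaA := S0coKq … (qKnitOfRecord …) (qsKnitOfRecord …) (parKnitY …) (GpPhysY … (parKnitY …))`: `GcoK 𝔏.GA U * ΔaA U = 1` and `ΔaA U * GcoK 𝔏.GA U = 1` whenever `β` is onto,
`knitRow17M₁ ≤ M`, `0 < α₀`, `Mα₀ ≤ knitRow17a₁` and `U ∈ (bg9YP … x).Reg335 c₃₅ α₀` (Thm 3.11 ⇒ `IsUnit Δ_a` ⇒ def-Y's coordinate inverse law; the reverse order by `mul_eq_one_comm`).
[cite: Balaban1985BackgroundPropagators, (3.26)–(3.27) p.395, Thm 3.11 p.416, (3.19) p.393, (3.35) p.396] -/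
theorem invLaws_GcoK_GA_S0coKq_at_scMember {R₁ R₂ : RegFamY θ.d₆ θ.ℓ₆ θ.hd' θ.hL' θ.b₀ θ.b₁ Mstar (Matrix (Fin N) (Fin N) ℂ)}
    (x : MemberY θ.d₆ θ.ℓ₆ θ.hd' θ.hL' θ.b₀ θ.b₁ Mstar) (hsurj : Function.Surjective (β x.hN x.D x.hk)) (hM : knitRow17M₁ N θ Mstar ≤ (geo9Y x).M)
    {α₀ : ℝ} (hα : 0 < α₀) (ha : (geo9Y x).M * α₀ ≤ knitRow17a₁ N θ Mstar)
    (U : (bg9YR (Matrix (Fin N) (Fin N) ℂ) (specialUnitaryUnits (Fin N)) R₁ R₂ x).Cfg)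
    (hU : (bg9YP (Matrix (Fin N) (Fin N) ℂ) (specialUnitaryUnits (Fin N)) x).Reg335 c35Y α₀ U) :
    GcoK x.toKIdx (trBasis N) (bg9YR (Matrix (Fin N) (Fin N) ℂ) (specialUnitaryUnits (Fin N)) R₁ R₂ x) (fun V => V)
        (lettersYOfRecordV11K N θ Mstar (resYOfRecordPK N θ Mstar) x).GA U *
      S0coKq x.toKIdx (trBasis N) (bg9YR (Matrix (Fin N) (Fin N) ℂ) (specialUnitaryUnits (Fin N)) R₁ R₂ x) (fun V => V)
        (qKnitOfRecord N θ x.toKIdx) (qsKnitOfRecord N θ x.toKIdx) (parKnitY x.toKIdx) (GpPhysY x.toKIdx (parKnitY x.toKIdx)) U = 1 ∧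
    S0coKq x.toKIdx (trBasis N) (bg9YR (Matrix (Fin N) (Fin N) ℂ) (specialUnitaryUnits (Fin N)) R₁ R₂ x) (fun V => V)
        (qKnitOfRecord N θ x.toKIdx) (qsKnitOfRecord N θ x.toKIdx) (parKnitY x.toKIdx) (GpPhysY x.toKIdx (parKnitY x.toKIdx)) U *
      GcoK x.toKIdx (trBasis N) (bg9YR (Matrix (Fin N) (Fin N) ℂ) (specialUnitaryUnits (Fin N)) R₁ R₂ x) (fun V => V)
        (lettersYOfRecordV11K N θ Mstar (resYOfRecordPK N θ Mstar) x).GA U = 1 := by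
  have hN : 0 < N := Nat.pos_of_ne_zero (NeZero.ne N)
  have hcR : cR39 (trBasis N) ≠ 0 := (cR39_trBasis_pos hN).ne'
  have hpos := (symm_posDefTr_deltaAQY_knitRecord_at_scMember_at N θ Mstar x hsurj hM α₀ hα ha U hU).2
  have h1 : GcoK x.toKIdx (trBasis N) (bg9YR (Matrix (Fin N) (Fin N) ℂ) (specialUnitaryUnits (Fin N)) R₁ R₂ x) (fun V => V)
        (lettersYOfRecordV11K N θ Mstar (resYOfRecordPK N θ Mstar) x).GA U *
      S0coKq x.toKIdx (trBasis N) (bg9YR (Matrix (Fin N) (Fin N) ℂ) (specialUnitaryUnits (Fin N)) R₁ R₂ x) (fun V => V)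
        (qKnitOfRecord N θ x.toKIdx) (qsKnitOfRecord N θ x.toKIdx) (parKnitY x.toKIdx) (GpPhysY x.toKIdx (parKnitY x.toKIdx)) U = 1 := by
    rw [lettersYOfRecordV11K_GA_phys]
    exact GcoK_GAQY_mul_S0coKq (𝔸 := Matrix (Fin N) (Fin N) ℂ) (i := x.toKIdx) (b := trBasis N)
      (B := bg9YR (Matrix (Fin N) (Fin N) ℂ) (specialUnitaryUnits (Fin N)) R₁ R₂ x) (cfg := fun V => V)
      (𝔮 := qKnitOfRecord N θ x.toKIdx) (𝔮s := qsKnitOfRecord N θ x.toKIdx) (parS := parKnitY x.toKIdx) (Gp := GpPhysY x.toKIdx (parKnitY x.toKIdx)) (U₁ := U)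
      hcR (isUnit_deltaAQY_phys_of_posDefTr _ (qKnitOfRecord N θ x.toKIdx) (qsKnitOfRecord N θ x.toKIdx) (parKnitY x.toKIdx) hpos)
  exact ⟨h1, mul_eq_one_comm.mp h1⟩

end Summit.QuantumFields.YangMills.BalabanUVNodes.N06DeltaAInverseAtRecord

end
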